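import Mathlib.Data.Nat.Factorial.Basic
import Mathlib.Algebra.Order.BigOperators.Group.Finset
import Mathlib.Algebra.Order.BigOperators.GroupWithZero.List
import Mathlib.Algebra.BigOperators.Ring.Finset
import Mathlib.Algebra.Order.Field.Basic
import Mathlib.Tactic.Positivity
import Mathlib.Tactic.FieldSimp
import Mathlib.Tactic.Ring
import Mathlib.Tactic.GCongr
import Literature.NumberTheory.Sieve.LenstraPomeranceCounting
import HarnessLib

/-!
# Products of `k` primes: the counting steps in the proof of LP92 Theorem 6.1

Combinatorial core of the proof of Theorem 6.1 of H. W. Lenstra Jr. and C. Pomerance,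
*A rigorous time bound for factoring integers*, J. Amer. Math. Soc. **5** (1992) 483–516
(pp. 499–500), for the objects of `LenstraPomeranceCounting` (`kProducts`, `ψ(x,y;𝓟)`,
`π(x;𝓟)`, `S(v,y;𝓟)`). The two counting facts used there ("no integer has more than `k!`
representations as a product of `k` primes") are proved in the forms

* `card_pow_le_factorial_mul_card_kProducts` : `(#Q)^k ≤ k! · #(kProducts Q k)`;
* `sum_inv_pow_le_factorial_mul_sum_inv_kProducts` :
  `(∑_{p ∈ Q} 1/p)^k ≤ k! · ∑_{m ∈ kProducts Q k} 1/m`,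

both by induction on `k` from the fibre bound `card_filter_mul_eq_le_card_primeFactors` (the
number of ways to write `m = p · m'` with `p ∈ Q` prime is at most `ω(m) ≤ Ω(m) = k + 1`), which
replaces the multinomial count of the paper. From these:

* `primeCountIn_pow_le` : `π(w;𝓟)^k ≤ k! · ψ(z, w; 𝓟)` whenever `w^k ≤ z` (first display on
  p. 500);
* `primeRecipSumIn_pow_le` : `S(v,y;𝓟)^k ≤ k! · ∑_{m ∈ 𝓜} 1/m` (third display on p. 500);
* `sum_smoothCountIn_div_le` : inequality (6.6), `ψ(x, y; 𝓟) ≥ ∑_{m ∈ 𝓜} ψ(x/m, w; 𝓟)` for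
  `𝓜 = kProducts Q k`, `Q` primes of `𝓟` in `(v, y]`, `w ≤ v`, `w ≤ y` (the map `(m, n) ↦ m·n`
  is injective because `m` is the part of `m·n` built from the primes `> w`).

Everything here is proved; no named facts.
-/

namespace Literature.NumberTheory.Sieve
namespace LenstraPomerance

open Finset

/-! ### Elementary properties of `kProducts` -/

/-- `1 ∈ kProducts Q 0`. [cite: LenstraPomerance1992, §6 (proof of Theorem 6.1, p. 499)] -/
theorem one_mem_kProducts_zero (Q : Finset ℕ) : 1 ∈ kProducts Q 0 := by simp

/-- Products of positive numbers are positive.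
[cite: LenstraPomerance1992, §6 (proof of Theorem 6.1, p. 499)] -/
theorem pos_of_mem_kProducts {Q : Finset ℕ} (hQ : ∀ p ∈ Q, 0 < p) {k m : ℕ}
    (hm : m ∈ kProducts Q k) : 0 < m := by
  obtain ⟨l, hlQ, -, rfl⟩ := mem_kProducts_iff.1 hm
  exact List.prod_pos fun p hp => hQ p (hlQ p hp)

/-- A product of naturals each `≤ B` is `≤ B ^ length`. [folklore] -/
theorem cast_prod_le_pow {B : ℝ} :
    ∀ l : List ℕ, (∀ p ∈ l, (p : ℝ) ≤ B) → ((l.prod : ℕ) : ℝ) ≤ B ^ l.length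
  | [], _ => by simp
  | p :: l, h => by
    have hp : (p : ℝ) ≤ B := h p (by simp)
    have ih := cast_prod_le_pow l fun q hq => h q (by simp [hq])
    have hB : 0 ≤ B := (Nat.cast_nonneg p).trans hp
    simp only [List.prod_cons, Nat.cast_mul, List.length_cons, pow_succ']
    exact mul_le_mul hp ih (by positivity) hB

/-- A product of naturals each `≥ A ≥ 0` is `≥ A ^ length`. [folklore] -/
theorem pow_le_cast_prod {A : ℝ} (hA : 0 ≤ A) :
    ∀ l : List ℕ, (∀ p ∈ l, A ≤ (p : ℝ)) → A ^ l.length ≤ ((l.prod : ℕ) : ℝ)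
  | [], _ => by simp
  | p :: l, h => by
    have hp : A ≤ (p : ℝ) := h p (by simp)
    have ih := pow_le_cast_prod hA l fun q hq => h q (by simp [hq])
    simp only [List.prod_cons, Nat.cast_mul, List.length_cons, pow_succ']
    exact mul_le_mul hp ih (by positivity) (by positivity)

/-- If every element of `Q` is at most `B`, the elements of `kProducts Q k` are at most `B ^ k`
(used with `B = y`: `m ≤ y^[u] ≤ x`). [cite: LenstraPomerance1992, §6 (proof of Theorem 6.1, (6.7))] -/
theorem cast_le_pow_of_mem_kProducts {Q : Finset ℕ} {B : ℝ} (hQ : ∀ p ∈ Q, (p : ℝ) ≤ B)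
    {k m : ℕ} (hm : m ∈ kProducts Q k) : (m : ℝ) ≤ B ^ k := by
  obtain ⟨l, hlQ, hlk, rfl⟩ := mem_kProducts_iff.1 hm
  simpa [hlk] using cast_prod_le_pow l fun p hp => hQ p (hlQ p hp)

/-- If every element of `Q` is at least `A ≥ 0`, the elements of `kProducts Q k` are at least
`A ^ k` (used with `A = v`: `m ≥ v^[u] > v^{u-1}`).
[cite: LenstraPomerance1992, §6 (proof of Theorem 6.1, (6.7))] -/
theorem pow_le_cast_of_mem_kProducts {Q : Finset ℕ} {A : ℝ} (hA : 0 ≤ A)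
    (hQ : ∀ p ∈ Q, A ≤ (p : ℝ)) {k m : ℕ} (hm : m ∈ kProducts Q k) : A ^ k ≤ (m : ℝ) := by
  obtain ⟨l, hlQ, hlk, rfl⟩ := mem_kProducts_iff.1 hm
  simpa [hlk] using pow_le_cast_prod hA l fun p hp => hQ p (hlQ p hp)

/-- For a set `Q` of primes, an element of `kProducts Q k` has exactly `k` prime factors counted
with multiplicity. [cite: LenstraPomerance1992, §6 (proof of Theorem 6.1, p. 500)] -/
theorem length_primeFactorsList_of_mem_kProducts {Q : Finset ℕ} (hQ : ∀ p ∈ Q, p.Prime)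
    {k m : ℕ} (hm : m ∈ kProducts Q k) : m.primeFactorsList.length = k := by
  obtain ⟨l, hlQ, hlk, rfl⟩ := mem_kProducts_iff.1 hm
  have hperm := Nat.primeFactorsList_unique (l := l) rfl fun p hp => hQ p (hlQ p hp)
  rw [← hperm.length_eq, hlk]

/-- For a set `Q` of primes, the prime factors of an element of `kProducts Q k` lie in `Q`.
[cite: LenstraPomerance1992, §6 (proof of Theorem 6.1, p. 499)] -/
theorem primeFactors_subset_of_mem_kProducts {Q : Finset ℕ} (hQ : ∀ p ∈ Q, p.Prime)
    {k m : ℕ} (hm : m ∈ kProducts Q k) : m.primeFactors ⊆ Q := by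
  obtain ⟨l, hlQ, -, rfl⟩ := mem_kProducts_iff.1 hm
  have hperm := Nat.primeFactorsList_unique (l := l) rfl fun p hp => hQ p (hlQ p hp)
  intro p hp
  rw [Nat.mem_primeFactors_iff_mem_primeFactorsList] at hp
  exact hlQ p (hperm.symm.subset hp)

/-- The prime-factor list of an element of `kProducts Q k` (for `Q` a set of primes) consists of
elements of `Q`. [cite: LenstraPomerance1992, §6 (proof of Theorem 6.1, p. 499)] -/
theorem mem_of_mem_primeFactorsList_of_mem_kProducts {Q : Finset ℕ} (hQ : ∀ p ∈ Q, p.Prime)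
    {k m : ℕ} (hm : m ∈ kProducts Q k) {p : ℕ} (hp : p ∈ m.primeFactorsList) : p ∈ Q := by
  obtain ⟨l, hlQ, -, rfl⟩ := mem_kProducts_iff.1 hm
  have hperm := Nat.primeFactorsList_unique (l := l) rfl fun p hp => hQ p (hlQ p hp)
  exact hlQ p (hperm.symm.subset hp)

/-- **Fibre bound.** For `m ≠ 0` and `Q` a set of primes, the number of ways of writing
`m = p · m'` with `p ∈ Q`, `m' ∈ T` is at most the number `ω(m)` of distinct prime factors of `m`.
[cite: LenstraPomerance1992, §6 (proof of Theorem 6.1, p. 500)] -/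
theorem card_filter_mul_eq_le_card_primeFactors {Q T : Finset ℕ} (hQ : ∀ p ∈ Q, p.Prime)
    {m : ℕ} (hm : m ≠ 0) : #{x ∈ Q ×ˢ T | x.1 * x.2 = m} ≤ #m.primeFactors := by
  refine Finset.card_le_card_of_injOn Prod.fst ?_ ?_
  · intro x hx
    rw [mem_coe, mem_filter, mem_product] at hx
    rw [mem_coe, Nat.mem_primeFactors]
    exact ⟨hQ _ hx.1.1, Dvd.intro _ hx.2, hm⟩
  · intro x hx x' hx' h
    rw [mem_coe, mem_filter, mem_product] at hx hx'
    have h1 : x.1 = x'.1 := h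
    have hp : x.1 ≠ 0 := (hQ _ hx.1.1).ne_zero
    have h2 : x.2 = x'.2 := by
      have : x.1 * x.2 = x.1 * x'.2 := by rw [hx.2, h1, hx'.2]
      exact Nat.eq_of_mul_eq_mul_left (Nat.pos_of_ne_zero hp) this
    exact Prod.ext h1 h2

/-- The number of distinct prime factors is at most the number of prime factors counted with
multiplicity: `ω(m) ≤ Ω(m)`. [folklore] -/
theorem card_primeFactors_le_length_primeFactorsList (m : ℕ) :
    #m.primeFactors ≤ m.primeFactorsList.length := by
  rw [← Nat.toFinset_factors]
  exact List.toFinset_card_le _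

/-- The fibres of the multiplication map `Q × kProducts Q k → kProducts Q (k+1)` have at most
`k + 1` elements (for `Q` a set of primes).
[cite: LenstraPomerance1992, §6 (proof of Theorem 6.1, p. 500)] -/
theorem card_fiber_le_succ {Q : Finset ℕ} (hQ : ∀ p ∈ Q, p.Prime) {k m : ℕ}
    (hm : m ∈ kProducts Q (k + 1)) (T : Finset ℕ) :
    #{x ∈ Q ×ˢ T | x.1 * x.2 = m} ≤ k + 1 := by
  have hm0 : m ≠ 0 := (pos_of_mem_kProducts (fun p hp => (hQ p hp).pos) hm).ne'
  calc #{x ∈ Q ×ˢ T | x.1 * x.2 = m} ≤ #m.primeFactors :=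
        card_filter_mul_eq_le_card_primeFactors hQ hm0
    _ ≤ m.primeFactorsList.length := card_primeFactors_le_length_primeFactorsList m
    _ = k + 1 := length_primeFactorsList_of_mem_kProducts hQ hm

/-- **Counting products of `k` primes.** A set of `π` primes yields at least `π^k / k!` distinct
products of `k` primes: `(#Q)^k ≤ k! · #(kProducts Q k)`. This is the inequality
`ψ ≥ π(w;𝓟)^{[l(m)]} / [l(m)]!` of the paper, in its combinatorial form.
[cite: LenstraPomerance1992, §6 (proof of Theorem 6.1, p. 500)] -/
theorem card_pow_le_factorial_mul_card_kProducts {Q : Finset ℕ} (hQ : ∀ p ∈ Q, p.Prime) :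
    ∀ k : ℕ, #Q ^ k ≤ k.factorial * #(kProducts Q k)
  | 0 => by simp
  | k + 1 => by
    have ih := card_pow_le_factorial_mul_card_kProducts hQ k
    have h1 : #(Q ×ˢ kProducts Q k) ≤ (k + 1) * #(kProducts Q (k + 1)) := by
      rw [kProducts_succ]
      refine Finset.card_le_mul_card_image _ _ ?_
      intro m hm
      exact card_fiber_le_succ hQ (by rwa [kProducts_succ]) _
    calc #Q ^ (k + 1) = #Q * #Q ^ k := pow_succ' _ _
      _ ≤ #Q * (k.factorial * #(kProducts Q k)) := Nat.mul_le_mul_left _ ih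
      _ = k.factorial * #(Q ×ˢ kProducts Q k) := by rw [card_product]; ring
      _ ≤ k.factorial * ((k + 1) * #(kProducts Q (k + 1))) := Nat.mul_le_mul_left _ h1
      _ = (k + 1).factorial * #(kProducts Q (k + 1)) := by rw [Nat.factorial_succ]; ring

/-- **Reciprocal sums over products of `k` primes.**
`(∑_{p ∈ Q} 1/p)^k ≤ k! · ∑_{m ∈ kProducts Q k} 1/m` for a set `Q` of primes — the inequality
`∑_{m ∈ 𝓜} 1/m ≥ S(v,y;𝓟)^{[u]} / [u]!` of the paper.
[cite: LenstraPomerance1992, §6 (proof of Theorem 6.1, p. 500)] -/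
theorem sum_inv_pow_le_factorial_mul_sum_inv_kProducts {Q : Finset ℕ} (hQ : ∀ p ∈ Q, p.Prime) :
    ∀ k : ℕ, (∑ p ∈ Q, (1 : ℝ) / p) ^ k ≤ k.factorial * ∑ m ∈ kProducts Q k, (1 : ℝ) / m
  | 0 => by simp
  | k + 1 => by
    have ih := sum_inv_pow_le_factorial_mul_sum_inv_kProducts hQ k
    set S := ∑ p ∈ Q, (1 : ℝ) / p with hSdef
    have hS : 0 ≤ S := sum_nonneg fun p _ => by positivity
    have key : S * ∑ m ∈ kProducts Q k, (1 : ℝ) / m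
        ≤ (k + 1) * ∑ m ∈ kProducts Q (k + 1), (1 : ℝ) / m := by
      rw [hSdef, Finset.sum_mul_sum, ← Finset.sum_product', kProducts_succ,
        ← Finset.sum_fiberwise_of_maps_to (s := Q ×ˢ kProducts Q k)
          (t := (Q ×ˢ kProducts Q k).image fun x => x.1 * x.2)
          (g := fun x : ℕ × ℕ => x.1 * x.2) fun x hx => mem_image_of_mem _ hx,
        Finset.mul_sum]
      refine Finset.sum_le_sum fun m hm => ?_
      have hfib : (#{x ∈ Q ×ˢ kProducts Q k | x.1 * x.2 = m} : ℝ) ≤ k + 1 := by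
        exact_mod_cast card_fiber_le_succ hQ (by rwa [kProducts_succ]) (kProducts Q k)
      have hm0 : (0 : ℝ) ≤ 1 / m := by positivity
      calc ∑ x ∈ Q ×ˢ kProducts Q k with x.1 * x.2 = m, 1 / (x.1 : ℝ) * (1 / (x.2 : ℝ))
          = ∑ x ∈ Q ×ˢ kProducts Q k with x.1 * x.2 = m, (1 : ℝ) / m := by
            refine sum_congr rfl fun x hx => ?_
            rw [mem_filter] at hx
            rw [← hx.2, Nat.cast_mul, one_div_mul_one_div]
        _ = #{x ∈ Q ×ˢ kProducts Q k | x.1 * x.2 = m} * ((1 : ℝ) / m) := by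
            rw [sum_const, nsmul_eq_mul]
        _ ≤ (k + 1) * ((1 : ℝ) / m) := mul_le_mul_of_nonneg_right hfib hm0
    calc S ^ (k + 1) = S * S ^ k := pow_succ' S k
      _ ≤ S * (k.factorial * ∑ m ∈ kProducts Q k, (1 : ℝ) / m) :=
          mul_le_mul_of_nonneg_left ih hS
      _ = k.factorial * (S * ∑ m ∈ kProducts Q k, (1 : ℝ) / m) := by ring
      _ ≤ k.factorial * ((k + 1) * ∑ m ∈ kProducts Q (k + 1), (1 : ℝ) / m) :=
          mul_le_mul_of_nonneg_left key (by positivity)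
      _ = (k + 1).factorial * ∑ m ∈ kProducts Q (k + 1), (1 : ℝ) / m := by
          push_cast [Nat.factorial_succ]; ring

/-! ### Products of `k` small primes are smooth: `π(w;P)^k ≤ k! ψ(z, w; P)` -/

/-- If `Q` consists of primes `p ≤ w` of `P` and `w ^ k ≤ z`, every product of `k` primes from `Q`
is counted by `ψ(z, w; P)`. [cite: LenstraPomerance1992, §6 (proof of Theorem 6.1, p. 500)] -/
theorem kProducts_subset_smoothSetIn {P : Set ℕ} {Q : Finset ℕ} {w z : ℝ} {k : ℕ}
    (hQ : ∀ p ∈ Q, p.Prime ∧ p ∈ P ∧ (p : ℝ) ≤ w) (hz : w ^ k ≤ z) :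
    kProducts Q k ⊆ smoothSetIn P z w := by
  intro m hm
  have hprime : ∀ p ∈ Q, p.Prime := fun p hp => (hQ p hp).1
  rw [mem_smoothSetIn]
  refine ⟨pos_of_mem_kProducts (fun p hp => (hprime p hp).pos) hm, ?_, ?_⟩
  · exact (cast_le_pow_of_mem_kProducts (fun p hp => (hQ p hp).2.2) hm).trans hz
  · intro p hp
    have hpQ := primeFactors_subset_of_mem_kProducts hprime hm hp
    exact ⟨(hQ p hpQ).2.2, (hQ p hpQ).2.1⟩

/-- **`π(w; P)^k ≤ k! · ψ(z, w; P)` whenever `w^k ≤ z`** (first display on p. 500 of the paper: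
`ψ(x/m, w; 𝓟) ≥ π(w;𝓟)^{[l(m)]}/[l(m)]!`).
[cite: LenstraPomerance1992, §6 (proof of Theorem 6.1, p. 500)] -/
theorem primeCountIn_pow_le (P : Set ℕ) {w z : ℝ} {k : ℕ} (hz : w ^ k ≤ z) :
    primeCountIn P w ^ k ≤ k.factorial * smoothCountIn P z w := by
  have hQ : ∀ p ∈ primesBelowIn P w, p.Prime ∧ p ∈ P ∧ (p : ℝ) ≤ w :=
    fun p hp => mem_primesBelowIn.1 hp
  calc primeCountIn P w ^ k ≤ k.factorial * #(kProducts (primesBelowIn P w) k) :=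
        card_pow_le_factorial_mul_card_kProducts (fun p hp => (hQ p hp).1) k
    _ ≤ k.factorial * smoothCountIn P z w :=
        Nat.mul_le_mul_left _ (card_le_card (kProducts_subset_smoothSetIn hQ hz))

/-- **`S(v, y; P)^k ≤ k! · ∑_{m ∈ 𝓜} 1/m`** for `𝓜` the products of `k` primes of `P` from
`(v, y]` (third display on p. 500 of the paper).
[cite: LenstraPomerance1992, §6 (proof of Theorem 6.1, p. 500)] -/
theorem primeRecipSumIn_pow_le (P : Set ℕ) (v y : ℝ) (k : ℕ) :
    primeRecipSumIn P v y ^ k ≤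
      k.factorial * ∑ m ∈ kProducts (primesBetweenIn P v y) k, (1 : ℝ) / m :=
  sum_inv_pow_le_factorial_mul_sum_inv_kProducts (fun _ hp => (mem_primesBetweenIn.1 hp).1) k

/-! ### Inequality (6.6): `ψ(x, y; P) ≥ ∑_{m ∈ 𝓜} ψ(x/m, w; P)` -/

/-- If all prime factors of `m` exceed `w` and all prime factors of `n` are `≤ w`, the prime
factors of `m · n` exceeding `w` are (with multiplicity) exactly those of `m`.
[cite: LenstraPomerance1992, §6 (proof of Theorem 6.1, (6.6))] -/
theorem filter_primeFactorsList_mul_perm {m n : ℕ} {w : ℝ} (hm : m ≠ 0) (hn : n ≠ 0)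
    (hmw : ∀ p ∈ m.primeFactorsList, w < (p : ℝ))
    (hnw : ∀ p ∈ n.primeFactorsList, (p : ℝ) ≤ w) :
    ((m * n).primeFactorsList.filter fun p : ℕ => decide (w < (p : ℝ))).Perm
      m.primeFactorsList := by
  have h := (Nat.perm_primeFactorsList_mul hm hn).filter fun p : ℕ => decide (w < (p : ℝ))
  rw [List.filter_append] at h
  have h1 : (m.primeFactorsList.filter fun p : ℕ => decide (w < (p : ℝ))) = m.primeFactorsList :=
    List.filter_eq_self.2 (by simpa using hmw)
  have h2 : (n.primeFactorsList.filter fun p : ℕ => decide (w < (p : ℝ))) = [] :=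
    List.filter_eq_nil_iff.2 (by simpa using hnw)
  rw [h1, h2, List.append_nil] at h
  exact h

/-- Cancellation of the "large-prime part": if `m₁ n₁ = m₂ n₂` where the `mᵢ` have all prime
factors `> w` and the `nᵢ` have all prime factors `≤ w`, then `m₁ = m₂`.
[cite: LenstraPomerance1992, §6 (proof of Theorem 6.1, (6.6))] -/
theorem eq_of_mul_eq_mul_of_primeFactors {m₁ n₁ m₂ n₂ : ℕ} {w : ℝ}
    (hm₁ : m₁ ≠ 0) (hn₁ : n₁ ≠ 0) (hm₂ : m₂ ≠ 0) (hn₂ : n₂ ≠ 0)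
    (hm₁w : ∀ p ∈ m₁.primeFactorsList, w < (p : ℝ))
    (hn₁w : ∀ p ∈ n₁.primeFactorsList, (p : ℝ) ≤ w)
    (hm₂w : ∀ p ∈ m₂.primeFactorsList, w < (p : ℝ))
    (hn₂w : ∀ p ∈ n₂.primeFactorsList, (p : ℝ) ≤ w)
    (h : m₁ * n₁ = m₂ * n₂) : m₁ = m₂ := by
  have p₁ := filter_primeFactorsList_mul_perm hm₁ hn₁ hm₁w hn₁w
  have p₂ := filter_primeFactorsList_mul_perm hm₂ hn₂ hm₂w hn₂w
  rw [h] at p₁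
  have hperm : m₁.primeFactorsList.Perm m₂.primeFactorsList := p₁.symm.trans p₂
  rw [← Nat.prod_primeFactorsList hm₁, ← Nat.prod_primeFactorsList hm₂]
  exact hperm.prod_eq

/-- **Inequality (6.6).** Let `Q` be a finite set of primes of `P` lying in `(v, y]`, `w ≤ v`,
`w ≤ y`, and `𝓜 = kProducts Q k`. Then `∑_{m ∈ 𝓜} ψ(x/m, w; P) ≤ ψ(x, y; P)`: the products
`m · n` (`m ∈ 𝓜`, `n` counted by `ψ(x/m, w; P)`) are distinct and counted by `ψ(x, y; P)`.
[cite: LenstraPomerance1992, §6 (proof of Theorem 6.1, (6.6))] -/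
theorem sum_smoothCountIn_div_le {P : Set ℕ} {Q : Finset ℕ} {x y v w : ℝ} (k : ℕ)
    (hQ : ∀ p ∈ Q, p.Prime ∧ p ∈ P ∧ v < (p : ℝ) ∧ (p : ℝ) ≤ y) (hwv : w ≤ v) (hwy : w ≤ y) :
    ∑ m ∈ kProducts Q k, smoothCountIn P (x / m) w ≤ smoothCountIn P x y := by
  classical
  have hprime : ∀ p ∈ Q, p.Prime := fun p hp => (hQ p hp).1
  have hpos : ∀ {m}, m ∈ kProducts Q k → 0 < m := fun hm =>
    pos_of_mem_kProducts (fun p hp => (hprime p hp).pos) hm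
  -- large-prime / small-prime information extracted from membership
  have hlarge : ∀ {m}, m ∈ kProducts Q k → ∀ p ∈ m.primeFactorsList, w < (p : ℝ) :=
    fun hm p hp => hwv.trans_lt (hQ p (mem_of_mem_primeFactorsList_of_mem_kProducts hprime hm hp)).2.2.1
  have hsmall : ∀ {m n}, n ∈ smoothSetIn P (x / m) w → ∀ p ∈ n.primeFactorsList, (p : ℝ) ≤ w :=
    fun hn p hp => ((mem_smoothSetIn.1 hn).2.2 p
      (Nat.mem_primeFactors_iff_mem_primeFactorsList.2 hp)).1
  have hcard : #((kProducts Q k).sigma fun m => smoothSetIn P (x / m) w)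
      = ∑ m ∈ kProducts Q k, smoothCountIn P (x / m) w := card_sigma _ _
  rw [← hcard]
  refine card_le_card_of_injOn (fun a => a.1 * a.2) ?_ ?_
  · rintro ⟨m, n⟩ hmn
    rw [mem_coe, mem_sigma] at hmn
    obtain ⟨hm, hn⟩ := hmn
    obtain ⟨hn1, hnx, hnp⟩ := mem_smoothSetIn.1 hn
    have hm0 : 0 < m := hpos hm
    have hm0' : (0 : ℝ) < m := by exact_mod_cast hm0
    rw [mem_coe, mem_smoothSetIn]
    refine ⟨Nat.mul_pos hm0 hn1, ?_, ?_⟩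
    · rw [Nat.cast_mul, mul_comm]
      exact (le_div_iff₀ hm0').1 hnx
    · intro p hp
      rw [Nat.primeFactors_mul hm0.ne' (by omega), mem_union] at hp
      rcases hp with hp | hp
      · have hpQ := primeFactors_subset_of_mem_kProducts hprime hm hp
        exact ⟨(hQ p hpQ).2.2.2, (hQ p hpQ).2.1⟩
      · exact ⟨(hnp p hp).1.trans hwy, (hnp p hp).2⟩
  · rintro ⟨m₁, n₁⟩ h₁ ⟨m₂, n₂⟩ h₂ heq
    rw [mem_coe, mem_sigma] at h₁ h₂
    dsimp only at h₁ h₂ heq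
    have hn₁ : n₁ ≠ 0 := Nat.one_le_iff_ne_zero.1 (mem_smoothSetIn.1 h₁.2).1
    have hn₂ : n₂ ≠ 0 := Nat.one_le_iff_ne_zero.1 (mem_smoothSetIn.1 h₂.2).1
    have hmm : m₁ = m₂ :=
      eq_of_mul_eq_mul_of_primeFactors (hpos h₁.1).ne' hn₁ (hpos h₂.1).ne' hn₂
        (hlarge h₁.1) (hsmall h₁.2) (hlarge h₂.1) (hsmall h₂.2) heq
    subst hmm
    have hnn : n₁ = n₂ := Nat.eq_of_mul_eq_mul_left (hpos h₁.1) heq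
    subst hnn
    rfl

end LenstraPomerance
end Literature.NumberTheory.Sieve
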